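import Summits.QuantumFields.BalabanUV.Beta.GAN24.LambdaSectorSlotSum
import Summits.QuantumFields.BalabanUV.Beta.GAN24.LambdaSlotWeightsTwoLevel
import Summits.QuantumFields.BalabanUV.Beta.GAN24.TaylorLamBracket
import Summits.QuantumFields.BalabanUV.Beta.GAN24.BornLambdaBracketLetter
import Summits.QuantumFields.BalabanUV.Beta.GAN24.ChargeTowerClimb

/-!
# `BalabanUV.Beta.GAN24.LambdaSectorSourcePairingZero` — binder row G-an2-4 ∕ (CONV-C), the (S) row ∕ (W-γ) one level up, the (ζ-Λ)∕(ε-Λ) step closed: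
# **THE LAGRANGE SECTOR OF THE SOURCE PAIRING IN CLOSED FORM AT EVERY LEVEL, AND ITS VANISHING FOR TWO-LEVEL DATA — `X^{Λ}_{j+1}(colH G_{j+1}(e); n, 1_{B(y₀)}) = 0`
# for bounded `Lc`-periodic `n` (`Lc` odd, centred root, every `j`); the level-0 literal `SLam Lc (lamCoeffOf (KInv Lc) Lc) hessFFAt` of `S0NAt` included**
# (G-an2-4 CRUX TEAM (2), seat `b2b-balaban-gan24-formalise-leaf-06` = the (γ) hand, gen 50, INTENT 1, PART B)

NOT IN PRINT; OUR BOOKKEEPING ([folklore] BY NAME over TODAY's PART A2 `LambdaSectorSlotSum.lambdaSector_slotSum_eq`, leaf-06 g49's (ε-Λ)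
`LambdaSlotWeightsTwoLevel.tsum_fieldResponse_mul_lamCoeffK` (the Λ-slot weights of a field response in closed form) ∕ `lambdaSlotSum_twoLevel_eq_zero` (their vanishing against the
table for two-level data, over (δ2b) `TwoLevelDefectVanishing` p352103), leaf-02's `TaylorLamBracket.lamCoeffOf_KInv_eq_neg_contourSumAdj_shift` and road-S3's
`RespStepEffectiveEL.lamCoeffK_KInvStep_E2_eq_neg_contourSumAdj` (the two tents agree at `j = 0`), `BornLambdaBracketLetter.wΦ_congrN`, `ChargeTowerClimb.summable_colH`; 0 `def`, 0 cited fact, 0 `def … : Prop`, 0 sorry).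
HONEST FRAMING (cell contract, verbatim): «discharging `BetaPertH` makes Bałaban's UV stability UNCONDITIONAL — a real constructive-QFT result; it is NOT the continuum limit and NOT
the Clay problem.»  HONEST DEPENDENCY (verbatim): «continuum YM on T⁴ ⇐ BetaPertH ∧ nine spine estimates (0/9 proved); BetaPertH ⇐ (D1) ∧ (D4) ∧ CAP+tail; G-an2-4 gates asym,
D1 and NE2/3/4.»

WHY.  PART A2 unfolds the Lagrange sector of B″'s `X_{j+1}(h; n, φ)` into `−cH_j·Σ'_Y Σ_μ T_j(μ,Y)·W_h(μ,Y)` with the slot weights `W_h(μ,Y) = Σ'_{u′} Σ_κ′ (H_j h)(κ′,u′)·lamCoeffK_j μ Y κ′ u′`.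
(ε-Λ) §2 computes `W_h(μ,Y) = −σ_j·stepScale_j⁻¹·Σ'_t Σ_l wΦ_{Lc^{j+1}} l μ (t − Y)·h l t` for bounded `h` at the centred root (§1: the Λ-LAW of ENGINE E31, «Λ = (2n^{2D})⁻¹·(C2′)» in the
tree's letters, every level, generic data), and (ε-Λ) §3 kills `Σ'_Y Σ_μ T_j·W_h` for the two-level datum `h = colH G_{j+1}(ν, y′)`, bounded `Lc`-periodic `n` and the block label
`φ = 1_{blk · = y₀}` (`Lc` odd): §2, THE LITERAL Λ-SECTOR OF `X_{j+1}` VANISHES — one third of road-P2's `hX` at every level (the border third is leaf-02 g61's PART 2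
`BorderSectorSourcePairingSucc`, the cubic third recurses by TODAY's `CubicSectorLevelDown`).  §3 bridges the base: `SrecAt 0 = S0NAt` carries its Λ member in the letters
`SLam Lc (lamCoeffOf (KInv Lc) Lc) hessFFAt`; the two coefficient functions agree pointwise (both are `−𝒬ᵀ_{Lc}` of the translated multiplier column `wΦ_{Lc}(·, μ, · − y)`), so §2 at
`j = 0` is the Λ third of `X_1` literally.
* §1 **`lambdaSector_slotSum_eq_closed`** (centred root, `h` direction-wise summable AND bounded, bounded `n`, `φ`): `X^{Λ}_{j+1}(h; n, φ) = cH_j·σ_j·stepScale_j⁻¹·Σ'_Y Σ_μ T_j(μ,Y)·(Σ'_t Σ_l wΦ_{Lc^{j+1}} l μ (t − Y)·h l t)`.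
* §2 **`lambdaSector_twoLevel_eq_zero`** (the statement in the title; the slot datum is direction-wise summable by road-P2's `ChargeTowerClimb.summable_colH`).
* §3 `lamCoeffOf_KInv_eq_lamCoeffK_zero`, `SLam_lamCoeffOf_eq_SLam_lamCoeffK_zero`, **`lambdaSector_S0NAt_twoLevel_eq_zero`** (the level-0 literal).
Asserts NO value of any resolvent column; the border and cubic sectors, the level-one closed form and the pin assembly (⇒ `hX`) are NOT here; NOTHING of (C2′) beyond (δ2b) ∕ `hX` ∕
(W-γ) at levels ≥ 1 ∕ (INV) ∕ (S) discharged; NEVER «G-an2-4 closed» as (CONV-C); NOT D1, NOT `BetaPertH`, NOT continuum, NOT Clay.  2026-08-23; no existing file touched.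
-/

noncomputable section

open Finset
open scoped BigOperators
open Literature.MathematicalPhysics.QuantumFieldTheory
open Literature.MathematicalPhysics.QuantumFieldTheory.Balaban1983to89
open Literature.MathematicalPhysics.QuantumFieldTheory.Balaban1983to89.Beta
open B12Sec2to5 (l1 l1_nonneg)
open ExpKernelCalculus (Site MKer Decays)
open OneStepResolventKernel (Fib KInv)
open AffineAveraging (Form1 box toSite unitVec dz)
open AffineReproduction (contourSumAdj)
open AveragingContours (blk)
open AveragingContoursRooted (ctrOff ctrOff_mem_box)
open AveragingHessianKernelsRooted (hessFFAt)
open InterLevelTransport (SLam)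
open KernelSpecInstance (wΦ)
open OneStepKernelFamily (KInvStep colH)
open BalabanStepJets (lamCoeffOf)
open BalabanStepJetsSucc (E2 lamCoeffK)
open Summit.QuantumFields.BalabanUV.Beta.AxialDressingRooted (coDressKBmAt one_le_of_neZero)
open Summit.QuantumFields.BalabanUV.Beta.BorderedHessian (stepScale)
open Summit.QuantumFields.BalabanUV.Beta.SpineRooted (e3OfK)
open Summit.QuantumFields.BalabanUV.Beta.GAN24.TaylorLamBracket (lamCoeffOf_KInv_eq_neg_contourSumAdj_shift)
open Summit.QuantumFields.BalabanUV.Beta.GAN24.RespStepEffectiveEL (lamCoeffK_KInvStep_E2_eq_neg_contourSumAdj)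
open Summit.QuantumFields.BalabanUV.Beta.GAN24.BornLambdaBracketLetter (wΦ_congrN)
open Summit.QuantumFields.BalabanUV.Beta.GAN24.LambdaSlotWeightsTwoLevel (tsum_fieldResponse_mul_lamCoeffK lambdaSlotSum_twoLevel_eq_zero)
open Summit.QuantumFields.BalabanUV.Beta.GAN24.LambdaSectorSlotSum (lambdaSector_slotSum_eq)
open Summit.QuantumFields.BalabanUV.Beta.GAN24.ChargeTowerClimb (summable_colH)

namespace Summit.QuantumFields.BalabanUV.Beta.GAN24.LambdaSectorSourcePairingZero

variable {d : ℕ} {Lc : ℕ} [NeZero Lc]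

/-! ## §1 The Lagrange sector in closed form (centred root) -/

omit [NeZero Lc] in
/-- [folklore] Scalar bookkeeping: `−(c·Σ'_Y Σ_μ A·(−(σ·(s·B)))) = c·(σ·s)·Σ'_Y Σ_μ A·B`. -/
theorem neg_mul_tsum_sum_mul_neg (c σ s : ℝ) (A B : Site (d + 1) → Fin (d + 1) → ℝ) :
    -(c * ∑' Y : Site (d + 1), ∑ μ : Fin (d + 1), A Y μ * -(σ * (s * B Y μ))) = c * (σ * s) * ∑' Y : Site (d + 1), ∑ μ : Fin (d + 1), A Y μ * B Y μ := by
  have e : ∀ Y : Site (d + 1), (∑ μ : Fin (d + 1), A Y μ * -(σ * (s * B Y μ))) = -(σ * s) * ∑ μ : Fin (d + 1), A Y μ * B Y μ := fun Y => by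
    rw [Finset.mul_sum]
    exact Finset.sum_congr rfl fun μ _ => by ring
  rw [tsum_congr e, tsum_mul_left]
  ring

/-- NOT IN PRINT; OUR BOOKKEEPING.  **THE LAGRANGE SECTOR OF THE SOURCE PAIRING IN CLOSED FORM** (centred root `ρ = toSite (ctrOff (d+1) Lc)`, every `j`, `h` summable along every direction
and bounded, bounded `n`, bounded `φ`; `σ_j = ((Lc^j)^{d+2})⁻¹`, `T_j(μ,Y)` the iterated constraint-Hessian table of PART A1∕A2):
`Σ_l Σ'_t h l t·Σ'_{(u,x)} Σ_κ Σ_κ₂ n κ u·dzφ κ₂ x·e3OfK Lc G_j (SLam Lc lamCoeffK_j (hessFFAt ρ Lc)) l t u x (inl κ)(inl κ₂) = cH_j·σ_j·stepScale_j⁻¹·Σ'_Y Σ_μ T_j(μ,Y)·(Σ'_t Σ_l wΦ_{Lc^{j+1}} l μ (t − Y)·h l t)`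
— PART A2 `lambdaSector_slotSum_eq` with the slot weights of (ε-Λ) §2 `tsum_fieldResponse_mul_lamCoeffK` inserted (ENGINE E31's Λ-law, every level, generic data). -/
theorem lambdaSector_slotSum_eq_closed (j : ℕ) {h : Form1 (d + 1) ℝ} (hh : ∀ l, Summable (h l)) {Bh : ℝ} (hhB : ∀ l t, |h l t| ≤ Bh)
    {n : Form1 (d + 1) ℝ} {Bn : ℝ} (hn : ∀ κ u, |n κ u| ≤ Bn) {φ : Site (d + 1) → ℝ} {Bφ : ℝ} (hφ : ∀ y, |φ y| ≤ Bφ) :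
    ∑ l, ∑' t : Site (d + 1), h l t * ∑' ux : Site (d + 1) × Site (d + 1), ∑ κ, ∑ κ₂, n κ ux.1 * dz φ κ₂ ux.2 *
        e3OfK Lc (coDressKBmAt (toSite (ctrOff (d + 1) Lc)) Lc (KInvStep (d := d) Lc j))
          (SLam Lc (lamCoeffK (KInvStep (d := d) Lc j) (E2 d Lc j) Lc) (fun μ y => hessFFAt (toSite (ctrOff (d + 1) Lc)) Lc μ y)) l t ux.1 ux.2 (Sum.inl κ) (Sum.inl κ₂)
      = (stepScale d Lc j * (Lc : ℝ) ^ (d + 1))⁻¹ * ((((Lc ^ j : ℕ) : ℝ) ^ (d + 2))⁻¹ * (stepScale d Lc j)⁻¹) *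
        ∑' Y : Site (d + 1), ∑ μ : Fin (d + 1),
          (∑' y : Site (d + 1), ∑ κ'' : Fin (d + 1),
            (∑ κ, ∑' u : Site (d + 1), n κ u * colH (coDressKBmAt (toSite (ctrOff (d + 1) Lc)) Lc (KInvStep (d := d) Lc j)) Lc κ u κ'' y)
              * (∑' w : Site (d + 1), ∑ a : Fin (d + 1), hessFFAt (toSite (ctrOff (d + 1) Lc)) Lc μ Y y w (Sum.inl κ'') (Sum.inl a) * dz (fun x => φ (blk Lc x)) a w))
          * (∑' t : Site (d + 1), ∑ l, wΦ (N := Lc ^ (j + 1)) l μ (t - Y) * h l t) := by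
  have hLc1 : 1 ≤ Lc := one_le_of_neZero Lc
  have hr := ctrOff_mem_box (d := d + 1) hLc1
  rw [lambdaSector_slotSum_eq hr j hh hn hφ]
  have hW : ∀ (μ : Fin (d + 1)) (Y : Site (d + 1)), (∑' u' : Site (d + 1), ∑ κ' : Fin (d + 1),
      (∑ l, ∑' t : Site (d + 1), h l t * colH (coDressKBmAt (toSite (ctrOff (d + 1) Lc)) Lc (KInvStep (d := d) Lc j)) Lc l t κ' u')
        * lamCoeffK (KInvStep (d := d) Lc j) (E2 d Lc j) Lc μ Y κ' u')
      = -((((Lc ^ j : ℕ) : ℝ) ^ (d + 2))⁻¹ * ((stepScale d Lc j)⁻¹ * ∑' t : Site (d + 1), ∑ l, wΦ (N := Lc ^ (j + 1)) l μ (t - Y) * h l t)) :=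
    fun μ Y => tsum_fieldResponse_mul_lamCoeffK (d := d) (Lc := Lc) j hhB μ Y
  simp only [hW]
  exact neg_mul_tsum_sum_mul_neg _ _ _ _ _

/-! ## §2 The Lagrange sector vanishes for two-level data -/

/-- NOT IN PRINT; OUR BOOKKEEPING.  **THE LAGRANGE SECTOR OF THE SOURCE PAIRING VANISHES FOR TWO-LEVEL DATA** (`Lc` odd, centred root `ρ = toSite (ctrOff (d+1) Lc)`, every level `j`,
every slot `(ν, y′)` of `G_{j+1}`, every bounded `Lc`-periodic `n`, every block label `y₀`): with the two-level slot datum `h = colH G_{j+1} Lc ν y′`,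
`Σ_l Σ'_t colH G_{j+1} Lc ν y′ l t·Σ'_{(u,x)} Σ_κ Σ_κ₂ n κ u·dz 1_{blk · = y₀} κ₂ x·e3OfK Lc G_j (SLam Lc lamCoeffK_j (hessFFAt ρ Lc)) l t u x (inl κ)(inl κ₂) = 0`
— PART A2 `lambdaSector_slotSum_eq` makes it `−cH_j·(the Λ-slot sum of (ε-Λ) §3)`, which `LambdaSlotWeightsTwoLevel.lambdaSlotSum_twoLevel_eq_zero` kills ((δ2b) `(C2′) = 0`).  This is
the LITERAL Λ third of B″'s `X_{j+1}(n, 1_{B(y₀)}; ν, y′)` (weight `cΛ·wΛ_j` stripped); for road-P2's datum `n := n⋆` the two hypotheses are `ExplicitSourceFormPeriodic` p353485. -/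
theorem lambdaSector_twoLevel_eq_zero (hLc : Odd Lc) (j : ℕ) (ν : Fin (d + 1)) (y' : Site (d + 1)) {n : Form1 (d + 1) ℝ} {Bn : ℝ}
    (hnB : ∀ l t, |n l t| ≤ Bn) (hper : ∀ (l : Fin (d + 1)) (t z : Site (d + 1)), n l (t + (Lc : ℤ) • z) = n l t) (y₀ : Site (d + 1)) :
    ∑ l, ∑' t : Site (d + 1), colH (coDressKBmAt (toSite (ctrOff (d + 1) Lc)) Lc (KInvStep (d := d) Lc (j + 1))) Lc ν y' l t *
        ∑' ux : Site (d + 1) × Site (d + 1), ∑ κ, ∑ κ₂, n κ ux.1 * dz (fun z : Site (d + 1) => if blk Lc z = y₀ then (1 : ℝ) else 0) κ₂ ux.2 *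
          e3OfK Lc (coDressKBmAt (toSite (ctrOff (d + 1) Lc)) Lc (KInvStep (d := d) Lc j))
            (SLam Lc (lamCoeffK (KInvStep (d := d) Lc j) (E2 d Lc j) Lc) (fun μ y => hessFFAt (toSite (ctrOff (d + 1) Lc)) Lc μ y)) l t ux.1 ux.2 (Sum.inl κ) (Sum.inl κ₂)
      = 0 := by
  have hLc1 : 1 ≤ Lc := one_le_of_neZero Lc
  have hr := ctrOff_mem_box (d := d + 1) hLc1
  have hh : ∀ l, Summable fun t : Site (d + 1) => colH (coDressKBmAt (toSite (ctrOff (d + 1) Lc)) Lc (KInvStep (d := d) Lc (j + 1))) Lc ν y' l t :=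
    fun l => summable_colH hr (j + 1) ν y' l
  have hφ : ∀ z : Site (d + 1), |(fun z : Site (d + 1) => if blk Lc z = y₀ then (1 : ℝ) else 0) z| ≤ 1 := fun z => by
    by_cases hz : blk Lc z = y₀ <;> simp [hz]
  have h1 := lambdaSector_slotSum_eq hr j hh hnB hφ
  rw [h1, lambdaSlotSum_twoLevel_eq_zero (d := d) hLc j ν y' hnB hper y₀, mul_zero, neg_zero]

/-! ## §3 The level-0 literal: `S0NAt`'s Lagrange member in the `lamCoeffK` letters -/

/-- [folklore] **THE TWO LAGRANGE COEFFICIENT FUNCTIONS AGREE AT LEVEL 0**: `lamCoeffOf (KInv Lc) Lc μ y κ u = lamCoeffK (KInvStep Lc 0) (E2 0) Lc μ y κ u` — both are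
`−𝒬ᵀ_{Lc}` of the translated multiplier column `wΦ_{Lc}(·, μ, · − y)` (leaf-02's tent at level 0, road-S3's tent at `j = 0` with `σ_0 = 1`, `Lc^{0+1} = Lc`). -/
theorem lamCoeffOf_KInv_eq_lamCoeffK_zero (μ : Fin (d + 1)) (y : Site (d + 1)) (κ : Fin (d + 1)) (u : Site (d + 1)) :
    lamCoeffOf (KInv (N := Lc) (d := d)) Lc μ y κ u = lamCoeffK (KInvStep (d := d) Lc 0) (E2 d Lc 0) Lc μ y κ u := by
  rw [lamCoeffOf_KInv_eq_neg_contourSumAdj_shift, lamCoeffK_KInvStep_E2_eq_neg_contourSumAdj]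
  have hs : (((Lc ^ 0 : ℕ) : ℝ) ^ (d + 2))⁻¹ = 1 := by simp
  rw [hs, one_mul]
  have e : (fun (κ' : Fin (d + 1)) (q : Site (d + 1)) => wΦ (N := Lc) (d := d) κ' μ (q - y))
      = fun (κ' : Fin (d + 1)) (y'' : Site (d + 1)) => wΦ (N := Lc ^ (0 + 1)) (d := d) κ' μ (y'' - y) := by
    funext κ' q
    exact (wΦ_congrN (show Lc ^ (0 + 1) = Lc by rw [zero_add, pow_one]) κ' μ (q - y)).symm
  rw [e]

/-- [folklore] Hence the two Lagrange members coincide: `SLam Lc (lamCoeffOf (KInv Lc) Lc) H = SLam Lc (lamCoeffK (KInvStep Lc 0) (E2 0) Lc) H` for every table family `H`. -/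
theorem SLam_lamCoeffOf_eq_SLam_lamCoeffK_zero (H : Fin (d + 1) → Site (d + 1) → MKer (d + 1) (Fib d)) :
    SLam Lc (lamCoeffOf (KInv (N := Lc) (d := d)) Lc) H = SLam Lc (lamCoeffK (KInvStep (d := d) Lc 0) (E2 d Lc 0) Lc) H := by
  have e : lamCoeffOf (KInv (N := Lc) (d := d)) Lc = lamCoeffK (KInvStep (d := d) Lc 0) (E2 d Lc 0) Lc := by
    funext μ y κ u
    exact lamCoeffOf_KInv_eq_lamCoeffK_zero μ y κ u
  rw [e]

/-- NOT IN PRINT; OUR BOOKKEEPING.  **THE LEVEL-0 LITERAL**: the Lagrange member of `SrecAt 0 = S0NAt`, `SLam Lc (lamCoeffOf (KInv Lc) Lc) (hessFFAt ρ Lc)` (weight `cΛ` stripped), contributes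
NOTHING to `X_1(n, 1_{B(y₀)}; ν, y′)` for `Lc` odd, centred root, bounded `Lc`-periodic `n`, every block label, every slot of `G_1` (§2 at `j = 0` through §3's bridge). -/
theorem lambdaSector_S0NAt_twoLevel_eq_zero (hLc : Odd Lc) (ν : Fin (d + 1)) (y' : Site (d + 1)) {n : Form1 (d + 1) ℝ} {Bn : ℝ}
    (hnB : ∀ l t, |n l t| ≤ Bn) (hper : ∀ (l : Fin (d + 1)) (t z : Site (d + 1)), n l (t + (Lc : ℤ) • z) = n l t) (y₀ : Site (d + 1)) :
    ∑ l, ∑' t : Site (d + 1), colH (coDressKBmAt (toSite (ctrOff (d + 1) Lc)) Lc (KInvStep (d := d) Lc 1)) Lc ν y' l t *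
        ∑' ux : Site (d + 1) × Site (d + 1), ∑ κ, ∑ κ₂, n κ ux.1 * dz (fun z : Site (d + 1) => if blk Lc z = y₀ then (1 : ℝ) else 0) κ₂ ux.2 *
          e3OfK Lc (coDressKBmAt (toSite (ctrOff (d + 1) Lc)) Lc (KInvStep (d := d) Lc 0))
            (SLam Lc (lamCoeffOf (KInv (N := Lc) (d := d)) Lc) (fun μ y => hessFFAt (toSite (ctrOff (d + 1) Lc)) Lc μ y)) l t ux.1 ux.2 (Sum.inl κ) (Sum.inl κ₂)
      = 0 := by
  rw [SLam_lamCoeffOf_eq_SLam_lamCoeffK_zero]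
  exact lambdaSector_twoLevel_eq_zero hLc 0 ν y' hnB hper y₀

end Summit.QuantumFields.BalabanUV.Beta.GAN24.LambdaSectorSourcePairingZero

end
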